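import Summits.HubbardSuperconductivity.HubbardSuperconductivity.Theorems.SgCorridor.Negative.AnchorFreezeBounds

/-!
# `SgCorridor` — negative side, part 4/4: the quantitative freezing theorem

Continuation of `AnchorFreezeBounds`. Assembles the energy sandwich and the pair-decorrelation bound
into the kernel statements behind the refutation of `ColourTheSpin.SgAnchorOrder`
(`Theorems/ColourTheSpinSgAnchorOrderRefutation.lean`, which only restates the last theorem here as
the literal negation of the route decl):

* `ground_electric_le` — every Rayleigh-form ground state of the `N_L`-block has electric excitation
  `g² Σ_b ‖E_b ψ̃‖² ≤ (34 + U) L² ‖ψ̃‖²` (`g ≥ 1`);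
* `not_blockOrder` — for `g ≥ 1`, `g² ≥ 32768(34+U)/c²`, `L² ≥ 128/c` some ground state of the block
  has gauged pair order `< c L⁴ ‖ψ‖²`, i.e. `¬ BlockOrder L U δ g c`;
* `not_blockOrder_eventually` — hence for EVERY `U ≥ 0, δ ≥ 0, c > 0, g₀, L₀` there are `g ≥ g₀` and an
  even `L ≥ L₀` with `¬ BlockOrder L U δ g c`: no half-line of gauge couplings carries a uniform anchor
  (this also makes `HalfLineOrder U δ` of `Cruxes/SgCorridor/Lines/birth.lean` uninhabited and
  discharges `stub_pairCeiling`-type statements of `Lines/anchor_vacuity.lean`).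

Theorems only. Refuter crux-attack 2026-08-17.
-/

-- `HubbardSuperconductivity.HubbardSuperconductivity` is the mandated Summit/Sub namespace (D-0017).
set_option linter.dupNamespace false

noncomputable section

namespace Summit.HubbardSuperconductivity.HubbardSuperconductivity.Theorems

namespace SgAnchorFreeze

open Literature.MathematicalPhysics.QuantumLattice Literature.Hubbard Matrix Finset
open scoped Kronecker ComplexOrder

set_option synthInstance.maxSize 1024

/-! ### The quantitative freezing theorem -/

section Main

/-- The real-arithmetic endgame. [folklore] -/
theorem arith_core {c ℓ n S₁ S₂ g U NP : ℝ} (hc : 0 < c) (hn : 0 < n) (hU : 0 ≤ U)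
    (hg : 32768 * (34 + U) / c ^ 2 ≤ g ^ 2) (hL : 128 / c ≤ ℓ ^ 2)
    (hP : NP ≤ 32 * ℓ ^ 2 * n ^ 2 + 64 * ℓ ^ 2 * n * S₁) (hCS : S₁ ^ 2 ≤ 2 * ℓ ^ 2 * S₂)
    (hS2 : g ^ 2 * S₂ ≤ (34 + U) * ℓ ^ 2 * n ^ 2) : NP < c * ℓ ^ 4 * n ^ 2 := by
  have h34 : 0 < 34 + U := by linarith
  have hc0 : c ≠ 0 := hc.ne'
  have h340 : (34 + U) ≠ 0 := h34.ne'
  have hT : 0 < 32768 * (34 + U) / c ^ 2 := by positivity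
  have hg2 : 0 < g ^ 2 := lt_of_lt_of_le hT hg
  have hℓ2 : 0 < ℓ ^ 2 := lt_of_lt_of_le (by positivity) hL
  have hS2' : S₂ ≤ (34 + U) * ℓ ^ 2 * n ^ 2 / g ^ 2 := by
    rw [le_div_iff₀ hg2]; linarith
  have hS1sq : S₁ ^ 2 ≤ (ℓ ^ 2 * n * c / 128) ^ 2 := by
    calc S₁ ^ 2 ≤ 2 * ℓ ^ 2 * S₂ := hCS
      _ ≤ 2 * ℓ ^ 2 * ((34 + U) * ℓ ^ 2 * n ^ 2 / g ^ 2) :=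
          mul_le_mul_of_nonneg_left hS2' (by positivity)
      _ = (2 * (34 + U) * ℓ ^ 4 * n ^ 2) / g ^ 2 := by ring
      _ ≤ (2 * (34 + U) * ℓ ^ 4 * n ^ 2) / (32768 * (34 + U) / c ^ 2) :=
          div_le_div_of_nonneg_left (by positivity) hT hg
      _ = (ℓ ^ 2 * n * c / 128) ^ 2 := by
          field_simp
          ring
  have hS1' : S₁ ≤ ℓ ^ 2 * n * c / 128 := le_of_pow_le_pow_left₀ two_ne_zero (by positivity) hS1sq
  have hA : 64 * ℓ ^ 2 * n * S₁ ≤ c / 2 * ℓ ^ 4 * n ^ 2 := by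
    calc 64 * ℓ ^ 2 * n * S₁ ≤ 64 * ℓ ^ 2 * n * (ℓ ^ 2 * n * c / 128) :=
          mul_le_mul_of_nonneg_left hS1' (by positivity)
      _ = c / 2 * ℓ ^ 4 * n ^ 2 := by ring
  have hB : 32 * ℓ ^ 2 * n ^ 2 ≤ c / 4 * ℓ ^ 4 * n ^ 2 := by
    have h128 : 128 ≤ ℓ ^ 2 * c := by rwa [div_le_iff₀ hc] at hL
    have hx : 0 ≤ ℓ ^ 2 * n ^ 2 := by positivity
    nlinarith [mul_le_mul_of_nonneg_right h128 hx]
  have hℓ4 : 0 < ℓ ^ 4 := by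
    have := mul_pos hℓ2 hℓ2
    linarith [show ℓ ^ 4 = ℓ ^ 2 * ℓ ^ 2 by ring]
  have hpos : 0 < c * ℓ ^ 4 * n ^ 2 := by positivity
  linarith

variable (L : ℕ)

/-- The `N_L`-particle block is nonempty: `N_L ≤ 2L²` for `δ ≥ 0`. [folklore] -/
theorem exists_config {δ : ℝ} (hδ : 0 ≤ δ) : ∃ s₀ : F L, s₀.card = 2 * ⌊(1 - δ) * (L : ℝ) ^ 2 / 2⌋₊ := by
  have hfl : ⌊(1 - δ) * (L : ℝ) ^ 2 / 2⌋₊ ≤ L ^ 2 := by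
    have h : (1 - δ) * (L : ℝ) ^ 2 / 2 ≤ ((L ^ 2 : ℕ) : ℝ) := by
      push_cast
      nlinarith [sq_nonneg (L : ℝ)]
    exact (Nat.floor_le_floor h).trans_eq (Nat.floor_natCast _)
  have hcT : Fintype.card (FermionTorus 2 L) = L ^ 2 := by simp [FermionTorus, Fintype.card_lex]
  have hco : Fintype.card (Orb (FermionTorus 2 L)) = 2 * L ^ 2 := by
    show Fintype.card (Lex (FermionTorus 2 L × Fin 2)) = _
    rw [Fintype.card_lex, Fintype.card_prod, hcT, Fintype.card_fin]; ring
  have hle : 2 * ⌊(1 - δ) * (L : ℝ) ^ 2 / 2⌋₊ ≤ (Finset.univ : Finset (Orb (FermionTorus 2 L))).card := by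
    rw [Finset.card_univ, hco]
    omega
  obtain ⟨t, -, ht⟩ := Finset.exists_subset_card_eq hle
  exact ⟨t, ht⟩

variable [NeZero L]

/-- The pair-order functional of a block vector is `‖Δ^g ψ̃‖²` of its extension by zero. [folklore] -/
theorem re_pair_block {δ : ℝ} (ψ : {ik // pN L δ ik} → ℂ) :
    (star ψ ⬝ᵥ ((PQ L)ᴴ * PQ L).toBlock (pN L δ) (pN L δ) *ᵥ ψ).re =
      eucNorm (PQ L *ᵥ ext0 (pN L δ) ψ) ^ 2 := by
  rw [star_dotProduct_toBlock_mulVec, ← mulVec_mulVec, dotProduct_mulVec, vecMul_conjTranspose,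
    star_star, ← eucNorm_sq]

/-- From the Rayleigh characterisation of a block ground state: the electric excitation of its
extension by zero is `O(L²/g²) ‖ψ‖²` (trial state + lower bound). [folklore] -/
theorem ground_electric_le {U δ g : ℝ} (hU : 0 ≤ U) (hg1 : 1 ≤ g) {s₀ : F L}
    (hs₀ : s₀.card = 2 * ⌊(1 - δ) * (L : ℝ) ^ 2 / 2⌋₊)
    (ψ : {ik // pN L δ ik} → ℂ) (E : ℝ)
    (hEψ : (HQ L U g).toBlock (pN L δ) (pN L δ) *ᵥ ψ = (E : ℂ) • ψ)
    (hRay : ∀ φ : {ik // pN L δ ik} → ℂ,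
      E * (star φ ⬝ᵥ φ).re ≤ (star φ ⬝ᵥ (HQ L U g).toBlock (pN L δ) (pN L δ) *ᵥ φ).re) :
    g ^ 2 * ∑ b, eucNorm (ext0 (pN L δ) ψ - lavg b (ext0 (pN L δ) ψ)) ^ 2 ≤
      (34 + U) * (L : ℝ) ^ 2 * eucNorm (ext0 (pN L δ) ψ) ^ 2 := by
  have hg0 : 0 < g := by linarith
  have hE1 : (star (ext0 (pN L δ) ψ) ⬝ᵥ (HQ L U g *ᵥ ext0 (pN L δ) ψ)).re =
      E * eucNorm (ext0 (pN L δ) ψ) ^ 2 := by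
    rw [← star_dotProduct_toBlock_mulVec, hEψ, dotProduct_smul, smul_eq_mul, Complex.re_ofReal_mul,
      star_dotProduct_block (pN L δ) ψ, eucNorm_sq]
  have hτext : ext0 (pN L δ) (fun a => trialV L s₀ a) = trialV L s₀ := by
    refine ext0_restrict _ _ fun i hi => ?_
    simp only [trialV]
    rw [if_neg]
    intro h
    exact hi (show i.1.card = _ by rw [h]; exact hs₀)
  have hR := hRay (fun a => trialV L s₀ a)
  rw [star_dotProduct_block (pN L δ), star_dotProduct_toBlock_mulVec, hτext, ← eucNorm_sq] at hR
  have ht := re_HQ_trial_le L hU hg0 s₀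
  have hτ2 : 0 < eucNorm (trialV L s₀) ^ 2 := by
    have := eucNorm_pos_of_ne_zero (trialV_ne_zero L s₀)
    positivity
  have hE : E ≤ 8 * Fintype.card (GaugedHubbard.Bond L) + U * Fintype.card (FermionTorus 2 L)
        + 1 / g ^ 2 * (2 * Fintype.card (FermionTorus 2 L)) := le_of_mul_le_mul_right (hR.trans ht) hτ2
  have hcT : Fintype.card (FermionTorus 2 L) = L ^ 2 := by simp [FermionTorus, Fintype.card_lex]
  rw [card_bond, hcT] at hE
  push_cast at hE
  have hlow := re_HQ_lower L hU hg0 (ext0 (pN L δ) ψ)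
  rw [card_bond] at hlow
  push_cast at hlow
  have hginv : 1 / g ^ 2 ≤ 1 := by
    rw [div_le_one (by positivity)]; nlinarith
  have h3 : 1 / g ^ 2 * (2 * (L : ℝ) ^ 2) ≤ 2 * (L : ℝ) ^ 2 := by
    have := mul_le_mul_of_nonneg_right hginv (by positivity : (0 : ℝ) ≤ 2 * (L : ℝ) ^ 2)
    linarith
  have hE' : E ≤ (18 + U) * (L : ℝ) ^ 2 := by linarith
  have h1 : E * eucNorm (ext0 (pN L δ) ψ) ^ 2 ≤ (18 + U) * (L : ℝ) ^ 2 * eucNorm (ext0 (pN L δ) ψ) ^ 2 :=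
    mul_le_mul_of_nonneg_right hE' (sq_nonneg _)
  linarith only [hlow, hE1, h1]

/-- **Electric freezing (quantitative).** For `g ≥ 1` with `g² ≥ 32768 (34 + U)/c²` and
`L² ≥ 128/c`, the `N_L`-block of `H_g(L,U)` has a ground state whose gauged pair order is
`< c L⁴ ‖ψ‖²`; hence `BlockOrder L U δ g c` fails. [folklore] -/
theorem not_blockOrder {U δ c g : ℝ} (hU : 0 ≤ U) (hδ : 0 ≤ δ) (hc : 0 < c) (hg1 : 1 ≤ g)
    (hg : 32768 * (34 + U) / c ^ 2 ≤ g ^ 2) (hL : 128 / c ≤ (L : ℝ) ^ 2) :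
    ¬ BlockOrder L U δ g c := by
  intro hBO
  obtain ⟨s₀, hs₀⟩ := exists_config L hδ
  haveI : Nonempty {ik // pN L δ ik} := ⟨⟨(s₀, fun _ => ((0 : Fin 2), (0 : ZMod 4))), hs₀⟩⟩
  have hH : ((HQ L U g).toBlock (pN L δ) (pN L δ)).IsHermitian :=
    (HQ_isHermitian L U g).submatrix Subtype.val
  obtain ⟨ψ, hψ0, E, hEψ, hRay⟩ := exists_ground hH
  have horder := hBO ψ ⟨hψ0, E, hEψ, hRay⟩
  have hS2 := ground_electric_le L hU hg1 hs₀ ψ E hEψ hRay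
  clear hBO hRay hEψ hH
  rw [star_dotProduct_block (pN L δ) ψ, ← eucNorm_sq, re_pair_block] at horder
  have hn : 0 < eucNorm (ext0 (pN L δ) ψ) := eucNorm_pos_of_ne_zero (ext0_ne_zero _ hψ0)
  generalize ext0 (pN L δ) ψ = v at horder hS2 hn
  have hP := eucNorm_PQ_mulVec_sq_le L v
  rw [card_bond] at hP
  push_cast at hP
  have hCS : (∑ b, eucNorm (v - lavg b v)) ^ 2 ≤ 2 * (L : ℝ) ^ 2 * ∑ b, eucNorm (v - lavg b v) ^ 2 := by
    have h := sq_sum_le_card_mul_sum_sq (s := (Finset.univ : Finset (GaugedHubbard.Bond L)))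
      (f := fun b => eucNorm (v - lavg b v))
    rw [Finset.card_univ, card_bond] at h
    push_cast at h
    exact h
  have hP' : eucNorm (PQ L *ᵥ v) ^ 2 ≤ 32 * (L : ℝ) ^ 2 * eucNorm v ^ 2
      + 64 * (L : ℝ) ^ 2 * eucNorm v * ∑ b, eucNorm (v - lavg b v) := by linarith
  have key := arith_core hc hn hU hg hL hP' hCS hS2
  linarith

omit [NeZero L] in
/-- **The anchor fails eventually along every half-line of gauge couplings.** [folklore] -/
theorem not_blockOrder_eventually (U δ c : ℝ) (hU : 0 ≤ U) (hδ : 0 ≤ δ) (hc : 0 < c)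
    (g₀ : ℝ) (L₀ : ℕ) :
    ∃ g : ℝ, g₀ ≤ g ∧ ∃ L : ℕ, ∃ _ : NeZero L, L₀ ≤ L ∧ Even L ∧ ¬ BlockOrder L U δ g c := by
  set T : ℝ := 32768 * (34 + U) / c ^ 2 with hT
  have hT0 : 0 ≤ T := by positivity
  set g : ℝ := max (max g₀ 1) (T + 1) with hgdef
  have hg1 : 1 ≤ g := (le_max_right g₀ 1).trans (le_max_left _ _)
  have hgT : T ≤ g ^ 2 := by
    have : T + 1 ≤ g := le_max_right _ _
    nlinarith
  set M : ℕ := L₀ + ⌈128 / c⌉₊ + 1 with hM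
  refine ⟨g, (le_max_left g₀ 1).trans (le_max_left _ _), 2 * M, ⟨by omega⟩, by omega, ⟨M, two_mul M⟩, ?_⟩
  refine not_blockOrder (2 * M) hU hδ hc hg1 hgT ?_
  have h1 : 128 / c ≤ ⌈128 / c⌉₊ := Nat.le_ceil _
  have h2 : (⌈128 / c⌉₊ : ℝ) + 1 ≤ ((2 * M : ℕ) : ℝ) := by
    rw [hM]; push_cast; linarith [(Nat.cast_nonneg L₀ : (0 : ℝ) ≤ L₀), (Nat.cast_nonneg ⌈128 / c⌉₊ : (0:ℝ) ≤ _)]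
  have h3 : (1 : ℝ) ≤ ((2 * M : ℕ) : ℝ) := by
    have := Nat.cast_nonneg (α := ℝ) ⌈128 / c⌉₊
    have hc' : (0 : ℝ) ≤ 128 / c := by positivity
    linarith
  nlinarith

end Main

end SgAnchorFreeze

end Summit.HubbardSuperconductivity.HubbardSuperconductivity.Theorems
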